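import Summits.HodgeConjecture.HodgeConjecture.Theorems.R90S1BposRamFixedUnitsHaar     -- ★ (6a) tool p864287 (R90-C10-p04 (g2)): substitution, INVERSION INVARIANCE, orthogonality on the fixed units
import Summits.HodgeConjecture.HodgeConjecture.Theorems.K2E3BranchBSkewLineIntegrals     -- ★ `measurable_dite_isUnit`, `norm_dite_apply_le_one`
import HarnessLib

/-!
# R90 · S1 ∕ U4Keys leaf (U4f-χ₁-ram-one-pos), BRANCH B AT A TAME RAMIFIED PLACE — brick (B-10)(6a-G) (G2)-PREP, FILE A: INVERSION BRIDGE AND THE FUBINI SWAP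
# `∫_C Ē(c)Ē(1+u c⁻¹) dν = ∫_C E(c)Ē(1+uc) dν` and `(∫_C E(c)Ē(1+uc) dν)² = ∫_C E(e)·[∫_C Ē(1+u(1+e)c) dν] dν(e)` modulo the additivity letter (FILE B: the value)
# [Keys1984 §4–§5, §7 Thm (2) (d); Rogawski1990 §12.2 (2); WeilBNT1967 Ch. II §5; IrelandRosen1990 Ch. 8 §2 Prop. 8.2.2]

Cell `pub/hodgecm-mathlib` (D-0151), SLAB R90-TF, section S1, crux H413 = `stmt-HodgeConjecture-24833` (lane `--supports … --as helper`), route of record `HCCMUnconditional`; prover seat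
`hodgecm-mathlib-R90-C10-p07` (g2); dealer deal 02:31:43Z ∕ R-S1-29 (β): the Fubini-swap + exact-additivity SKELETON of the Gauss-sum square behind (G2) `Φcrit² · X = q⁻¹ · μ⁻(B₀)²`, typed
HYPOTHESIS-FIRST and PART-FREE (imports only the ★ fixed-units tool): the analytic inputs of ★-to-be (6a) PART 1∕2 (exact additivity of `Ē(1+·)` at the critical level, the two inner
integrals) enter as LETTERS which R90-C10-p04 (g3)'s (β) `R90S1BposRamGaussSphereValues` discharges.  THEOREMS ONLY (no `def` ∕ `instance` ∕ notation ∕ named-fact hypothesis ∕ `sorry`).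
NOT THE PAYER of :182.

FRAME: `R := LocalRing L v` at a NON-SPLIT place (`w`, `hw`); `σ := conjLocal L c v`; `R⁺ := HeisRing.fixedPart σ` with an ABSTRACT regular additive Haar measure `ν` (p04: `ν := μ⁻.map M⁻¹`,
`M c = δc`); the fixed units `C := {c ∈ R⁺ : |c_w| = 1}`, `𝔪⁺ := {|c_w| < 1}`, `𝒪⁺ := {|c_w| ≤ 1}`, `T := {e ∈ R⁺ : |(1+e)_w| < 1}` (`= −1 + 𝔪⁺`); `E(r) := χ₁(r̂)`, `Ē(r) := χ₁(r̂)⁻¹` (★ inline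
`dite`s, BYTE FOR BYTE); an OPAQUE skew parameter `u : R` with `|u_w| < 1` (p04: `u := −a·δ⁻¹`, `|u| = |ϖ|^m`).  LETTERS: `hB` (Branch B, ★ (7) bytes), `hfixP` (★ p863838 bytes), `hFε`
(the (R-b) witness, ★ (G3) bytes), **`hadd`** `Ē(1+uc)·Ē(1+u(ce)) = Ē(1+u(1+e)c)` on `C × C` (⇐ PART 1 `diteInv_one_add_mul_one_add_eq`), **`hI₁`** `∫_C Ē(1+u(1+e)c) dν = −ν(𝔪⁺)` for
`|1+e| = 1` (⇐ PART 2 `setIntegral_fixedUnits_diteInv_inner_eq_neg`), **`hI₀`** `= ν(C)` for `|1+e| < 1` (⇐ PART 2 `setIntegral_diteInv_one_add_mul_eq_measureReal`).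
* §0 small facts (`χ₁⁻¹` continuous, `E(r⁻¹) = Ē(r)` and `|E|, |Ē| ≤ 1` on units of level one, `E(c)E(ce) = E(e)` by `hB`, measurability ∕ finiteness of `C, 𝔪⁺, 𝒪⁺, T`).
* §1 INVERSION BRIDGE `∫_C Ē(c)Ē(1+u c⁻¹) dν = ∫_C E(c)Ē(1+uc) dν` (★ tool, inversion-free `g`).
* §2 THE SWAP `(∫_C E(c)Ē(1+uc) dν)² = ∫_C E(e)·[∫_C Ē(1+u(1+e)c) dν(c)] dν(e)` (product ↦ double integral, `c′ = c·e` ★ tool substitution, `hB`, `hadd`, Fubini).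
* FILE B `R90S1BposRamGaussSquareModLetters` (this seat): the character masses on `C ∩ T`, `C ∖ T`, the value `χ₁(−1)·ν(𝔪⁺)·ν(𝒪⁺)` of the square and the (β) target shape `Φ²·X = q⁻¹·ν(𝒪⁺)²`.
HONEST LABEL.  HC_CM is proved only modulo the 7 printed citations (2 remaining named inputs: hLiu418 = `stmt-HodgeConjecture-24832`, h413 = `stmt-HodgeConjecture-24833`) until rung 0
closes; count-neutral — this file does NOT pay :182 (nor :155, nor A2′); no printed citation is discharged; REL ≠ ★ ≠ BUILT.

## References
* [Keys1984] D. Keys, *Principal series representations of special unitary groups over local fields*, Compositio Math. 51 (1984), §4–§5, §7 Theorem (2) (d) p. 126.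
* [Rogawski1990] J. D. Rogawski, *Automorphic Representations of Unitary Groups in Three Variables*, Ann. of Math. Stud. 123 (1990), §12.2 (2) p. 173.
* [WeilBNT1967] A. Weil, *Basic Number Theory* (1967), Ch. I §2, Ch. II §5.
* [IrelandRosen1990] K. Ireland, M. Rosen, *A Classical Introduction to Modern Number Theory*, 2nd ed., GTM 84 (1990), Ch. 8 §2 Prop. 8.2.2 (`g² = χ(−1)p`).
-/

set_option autoImplicit false
-- the mandated namespace has the single-problem summit's repeated segment (`HodgeConjecture.HodgeConjecture`)
set_option linter.dupNamespace false

noncomputable section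
open NumberField IsDedekindDomain MeasureTheory Measure Topology Set
open scoped NNReal ENNReal
open Literature.NumberTheory Literature.NumberTheory.Automorphic Literature.NumberTheory.Automorphic.UnitaryGroup

namespace Summit.HodgeConjecture.HodgeConjecture.R90.S1.BposRamGaussSquarePrep

open Summit.HodgeConjecture.HodgeConjecture.Cruxes.H413
open Summit.HodgeConjecture.HodgeConjecture.Cruxes.H413.K2E3BranchBSkewLineIntegrals
open Summit.HodgeConjecture.HodgeConjecture.Cruxes.H413.K2E3BranchBSkewLineCharacterIntegral
open Summit.HodgeConjecture.HodgeConjecture.Cruxes.H413.K2E3BranchBSkewUnitSign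
open Summit.HodgeConjecture.HodgeConjecture.R90.S1.BposRamFixedUnitsHaar

variable (L : Type) [Field L] [NumberField L] [IsCMField L] (v : HeightOneSpectrum (𝓞 ↥(maximalRealSubfield L)))
  (w : PlacesOver L v) (hw : IsCMField.complexConj L • w.1 = w.1)

/-! ## §0 Small facts: `χ₁⁻¹`, the two `dite`s on units of level one, `E(c)E(ce) = E(e)`, the sets `C, 𝔪⁺, 𝒪⁺, T` -/
omit [IsCMField L] in
/-- `x ↦ χ₁(x)⁻¹` is continuous when `x ↦ χ₁(x)` is. [folklore] -/
theorem continuous_chiInv (χ₁ : (LocalRing L v)ˣ →* ℂˣ) (h₁ : Continuous fun x => ((χ₁ x : ℂˣ) : ℂ)) :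
    Continuous fun x => (((χ₁ x)⁻¹ : ℂˣ) : ℂ) := by
  have h : (fun x => (((χ₁ x)⁻¹ : ℂˣ) : ℂ)) = fun x => (((χ₁ x : ℂˣ) : ℂ))⁻¹ := funext fun x => Units.val_inv_eq_inv_val _
  rw [h]
  exact h₁.inv₀ fun x => Units.ne_zero _
open scoped Classical in
include hw in
/-- `|Ē(r)| ≤ 1` for `|r_w| = 1` (★ `norm_dite_apply_le_one` for `χ₁⁻¹`). [cite: Keys1984, §7] -/
theorem norm_diteInv_apply_le_one (χ₁ : (LocalRing L v)ˣ →* ℂˣ) (h₁ : Continuous fun x => ((χ₁ x : ℂˣ) : ℂ)) (r : LocalRing L v) (hr : Valued.v (r w) = 1) :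
    ‖(if h : IsUnit r then (((χ₁ h.unit)⁻¹ : ℂˣ) : ℂ) else 0)‖ ≤ 1 := by
  have h₁' : Continuous fun x => ((χ₁⁻¹ x : ℂˣ) : ℂ) := by simp_rw [MonoidHom.inv_apply]; exact continuous_chiInv L v χ₁ h₁
  have h := norm_dite_apply_le_one L v w hw χ₁⁻¹ h₁' r hr
  simpa only [MonoidHom.inv_apply] using h
omit [IsCMField L] in
/-- `|(1 + u·t)_w| = 1` when `|u_w| < 1` and `|t_w| ≤ 1`. [cite: WeilBNT1967, Ch. I §2] -/
theorem valued_one_add_mul_apply_eq_one {u t : LocalRing L v} (hu : Valued.v (u w) < 1) (ht : Valued.v (t w) ≤ 1) : Valued.v ((1 + u * t) w) = 1 := by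
  rw [Pi.add_apply, Pi.one_apply, Pi.mul_apply]
  exact Valuation.map_one_add_of_lt _ (by rw [map_mul]; exact (mul_le_of_le_one_right' ht).trans_lt hu)
omit [IsCMField L] in
/-- `|(1 + e)_w| ≤ 1` for `|e_w| = 1`. [cite: WeilBNT1967, Ch. I §2] -/
theorem valued_one_add_apply_le_one {e : LocalRing L v} (he : Valued.v (e w) = 1) : Valued.v ((1 + e) w) ≤ 1 := by
  rw [Pi.add_apply, Pi.one_apply]
  exact (Valuation.map_add _ _ _).trans (by rw [map_one, he, max_self])
open scoped Classical in
include hw in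
/-- `E(r⁻¹) = Ē(r)` for `|r_w| = 1` (`r⁻¹ = r̂⁻¹`, ★ tool). [cite: WeilBNT1967, Ch. I §2] -/
theorem dite_inv_eq_diteInv (χ₁ : (LocalRing L v)ˣ →* ℂˣ) (r : LocalRing L v) (hr : Valued.v (r w) = 1) :
    (if h : IsUnit r⁻¹ then ((χ₁ h.unit : ℂˣ) : ℂ) else 0) = (if h : IsUnit r then (((χ₁ h.unit)⁻¹ : ℂˣ) : ℂ) else 0) := by
  have hU := isUnit_of_valued_eq_one L v w hw hr
  have hinv : r⁻¹ = (((hU.unit⁻¹ : (LocalRing L v)ˣ)) : LocalRing L v) := inv_eq_units_inv_of_valued_eq_one L v w hw hr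
  rw [dif_pos hU, hinv, dif_pos (Units.isUnit _), IsUnit.unit_of_val_units, map_inv]
open scoped Classical in
include hw in
/-- **`E(c)·E(c·e) = E(e)` ON THE FIXED UNITS** (Branch B: `χ₁(ĉ)² = χ₁(ĉ·σĉ) = 1`). [cite: Rogawski1990, §12.2 (2) p. 173] [cite: Keys1984, §7 Theorem (2) (d) p. 126] -/
theorem dite_mul_dite_mul_eq_of_branchB (χ₁ : (LocalRing L v)ˣ →* ℂˣ)
    (hB : ∀ u : (LocalRing L v)ˣ, (∀ w' : PlacesOver L v, Valued.v ((u : LocalRing L v) w') = 1) →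
      χ₁ (u * Units.map (conjLocal L (IsCMField.complexConj L) v : LocalRing L v →* LocalRing L v) u) = 1)
    {c : LocalRing L v} (hσc : conjLocal L (IsCMField.complexConj L) v c = c) (hc : Valued.v (c w) = 1) (e : LocalRing L v) :
    (if h : IsUnit c then ((χ₁ h.unit : ℂˣ) : ℂ) else 0) * (if h : IsUnit (c * e) then ((χ₁ h.unit : ℂˣ) : ℂ) else 0) =
      (if h : IsUnit e then ((χ₁ h.unit : ℂˣ) : ℂ) else 0) := by
  have hU := isUnit_of_valued_eq_one L v w hw hc
  have hmap : Units.map (conjLocal L (IsCMField.complexConj L) v : LocalRing L v →* LocalRing L v) hU.unit = hU.unit :=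
    Units.ext (by rw [Units.coe_map, MonoidHom.coe_coe, IsUnit.unit_spec, hσc])
  have hsq : χ₁ hU.unit * χ₁ hU.unit = 1 := by
    rw [← map_mul]
    have h := hB hU.unit (forall_placesOver_of_apply L v w hw (P := fun w' => Valued.v ((hU.unit : LocalRing L v) w') = 1) (by rw [IsUnit.unit_spec]; exact hc))
    rwa [hmap] at h
  have h2 := dite_chi_units_mul L v χ₁ hU.unit e
  rw [IsUnit.unit_spec] at h2
  beta_reduce at h2
  rw [h2, dif_pos hU, ← mul_assoc, ← Units.val_mul, hsq, Units.val_one, one_mul]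
include hw in
/-- **`χ₁(δ′)² = χ₁(−1)·χ₁(σΠ̂·Π̂)`** for a SKEW unit `δ′` (`σδ′ = −δ′`) of valuation `exp(−1)` and any uniformiser unit `Π̂` (`|Π̂_{w′}| = exp(−1)`): `δ′² = −δ′·σδ′`, `δ′ = e·Π̂` with `|e| = 1`,
`δ′σδ′ = (eσe)(σΠ̂·Π̂)` and `χ₁(eσe) = 1` (Branch B) — the ONE-CURRENCY bridge. [cite: Rogawski1990, §12.2 (2) p. 173] [cite: Keys1984, §7 Theorem (2) (d) p. 126] -/
theorem chi_skewUnit_sq (χ₁ : (LocalRing L v)ˣ →* ℂˣ)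
    (hB : ∀ u : (LocalRing L v)ˣ, (∀ w' : PlacesOver L v, Valued.v ((u : LocalRing L v) w') = 1) →
      χ₁ (u * Units.map (conjLocal L (IsCMField.complexConj L) v : LocalRing L v →* LocalRing L v) u) = 1)
    (piU : (LocalRing L v)ˣ) (hpiU : ∀ w' : PlacesOver L v, Valued.v ((piU : LocalRing L v) w') = WithZero.exp (-1 : ℤ))
    (δ' : (LocalRing L v)ˣ) (hδ'σ : conjLocal L (IsCMField.complexConj L) v (δ' : LocalRing L v) = -(δ' : LocalRing L v))
    (hδ'v : Valued.v ((δ' : LocalRing L v) w) = WithZero.exp (-1 : ℤ)) :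
    ((χ₁ δ' : ℂˣ) : ℂ) ^ 2 = ((χ₁ (-1) : ℂˣ) : ℂ) * ((χ₁ (Units.map (conjLocal L (IsCMField.complexConj L) v : LocalRing L v →* LocalRing L v) piU * piU) : ℂˣ) : ℂ) := by
  set σu := (Units.map (conjLocal L (IsCMField.complexConj L) v : LocalRing L v →* LocalRing L v)) with hσu
  set e : (LocalRing L v)ˣ := δ' * piU⁻¹ with hedef
  have h1 : e * piU = δ' := inv_mul_cancel_right δ' piU
  have he1 : ∀ w' : PlacesOver L v, Valued.v ((e : LocalRing L v) w') = 1 := by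
    refine forall_placesOver_of_apply L v w hw (P := fun w' => Valued.v ((e : LocalRing L v) w') = 1) ?_
    have h := congrArg (fun x : (LocalRing L v)ˣ => Valued.v ((x : LocalRing L v) w)) h1
    simp only [Units.val_mul, Pi.mul_apply, map_mul, hpiU w, hδ'v] at h
    exact (mul_eq_right₀ WithZero.exp_ne_zero).1 h
  have hmap : σu δ' = -δ' := Units.ext (by rw [hσu, Units.coe_map, MonoidHom.coe_coe, hδ'σ, Units.val_neg])
  have hsq : δ' * δ' = -1 * ((e * σu e) * (σu piU * piU)) := by
    rw [mul_comm (σu piU) piU, mul_mul_mul_comm e (σu e) piU (σu piU), ← map_mul, h1, hmap, mul_neg, neg_one_mul, neg_neg]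
  rw [sq, ← Units.val_mul, ← map_mul, hsq, map_mul, map_mul, hB e he1, one_mul, Units.val_mul]

section Sets
variable [MeasurableSpace (LocalRing L v)] [BorelSpace (LocalRing L v)]
  (ν : Measure ↥(HeisRing.fixedPart (conjLocal L (IsCMField.complexConj L) v)))
/-- `𝔪⁺`, `𝒪⁺` and `T = {e : |(1+e)_w| < 1}` are Borel in `R⁺`. [cite: WeilBNT1967, Ch. I §2] -/
theorem measurableSet_fixedBalls :
    MeasurableSet {d : ↥(HeisRing.fixedPart (conjLocal L (IsCMField.complexConj L) v)) | Valued.v ((d : LocalRing L v) w) < 1} ∧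
      MeasurableSet {d : ↥(HeisRing.fixedPart (conjLocal L (IsCMField.complexConj L) v)) | Valued.v ((d : LocalRing L v) w) ≤ 1} ∧
      MeasurableSet {e : ↥(HeisRing.fixedPart (conjLocal L (IsCMField.complexConj L) v)) | Valued.v ((1 + (e : LocalRing L v)) w) < 1} := by
  refine ⟨measurable_subtype_coe (isOpen_setOf_valued_apply_lt_one L v w).measurableSet,
    measurable_subtype_coe (isClosed_setOf_valued_apply_le_one L v w).measurableSet, ?_⟩
  exact (continuous_const.add continuous_subtype_val).measurable (isOpen_setOf_valued_apply_lt_one L v w).measurableSet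
end Sets

section Haar
variable [MeasurableSpace (LocalRing L v)] [BorelSpace (LocalRing L v)]
  (ν : Measure ↥(HeisRing.fixedPart (conjLocal L (IsCMField.complexConj L) v))) [ν.IsAddHaarMeasure] [ν.Regular]
  (χ₁ : (LocalRing L v)ˣ →* ℂˣ) (h₁ : Continuous fun x => ((χ₁ x : ℂˣ) : ℂ)) {u : LocalRing L v} (hu : Valued.v (u w) < 1)

omit [ν.Regular] [BorelSpace (LocalRing L v)] in
include hw in
/-- `ν(𝒪⁺) < ∞` and `ν(𝔪⁺) < ∞`: `𝒪⁺` is the preimage of the compact unit ball of `R` under the closed embedding `R⁺ ↪ R`. [cite: WeilBNT1967, Ch. I §2] -/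
theorem measure_fixedBall_lt_top : ν {d : ↥(HeisRing.fixedPart (conjLocal L (IsCMField.complexConj L) v)) | Valued.v ((d : LocalRing L v) w) ≤ 1} < ∞ ∧ ν {d : ↥(HeisRing.fixedPart (conjLocal L (IsCMField.complexConj L) v)) | Valued.v ((d : LocalRing L v) w) < 1} < ∞ := by
  have hσc := continuous_conjLocal L (IsCMField.complexConj L) v
  have hcl : Topology.IsClosedEmbedding (Subtype.val : ↥(HeisRing.fixedPart (conjLocal L (IsCMField.complexConj L) v)) → LocalRing L v) :=
    (HeisRing.isClosed_fixedPart (conjLocal L (IsCMField.complexConj L) v) hσc).isClosedEmbedding_subtypeVal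
  have hK : IsCompact {d : ↥(HeisRing.fixedPart (conjLocal L (IsCMField.complexConj L) v)) | Valued.v ((d : LocalRing L v) w) ≤ 1} := hcl.isCompact_preimage (isCompact_setOf_valued_apply_le_one L v w hw)
  exact ⟨hK.measure_lt_top, lt_of_le_of_lt (measure_mono fun d (hd : Valued.v ((d : LocalRing L v) w) < 1) => hd.le) hK.measure_lt_top⟩
omit [ν.IsAddHaarMeasure] [ν.Regular] in
/-- `𝒪⁺ = C ⊔ 𝔪⁺`, so `ν(𝒪⁺) = ν(C) + ν(𝔪⁺)` for finite pieces. [cite: WeilBNT1967, Ch. I §2] -/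
theorem measureReal_fixedBall_eq_add (hC : ν {c : ↥(HeisRing.fixedPart (conjLocal L (IsCMField.complexConj L) v)) | Valued.v ((c : LocalRing L v) w) = 1} ≠ ∞) (hm : ν {d : ↥(HeisRing.fixedPart (conjLocal L (IsCMField.complexConj L) v)) | Valued.v ((d : LocalRing L v) w) < 1} ≠ ∞) :
    ν.real {d : ↥(HeisRing.fixedPart (conjLocal L (IsCMField.complexConj L) v)) | Valued.v ((d : LocalRing L v) w) ≤ 1} = ν.real {c : ↥(HeisRing.fixedPart (conjLocal L (IsCMField.complexConj L) v)) | Valued.v ((c : LocalRing L v) w) = 1} + ν.real {d : ↥(HeisRing.fixedPart (conjLocal L (IsCMField.complexConj L) v)) | Valued.v ((d : LocalRing L v) w) < 1} := by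
  have hset : {d : ↥(HeisRing.fixedPart (conjLocal L (IsCMField.complexConj L) v)) | Valued.v ((d : LocalRing L v) w) ≤ 1} = {c : ↥(HeisRing.fixedPart (conjLocal L (IsCMField.complexConj L) v)) | Valued.v ((c : LocalRing L v) w) = 1} ∪ {d : ↥(HeisRing.fixedPart (conjLocal L (IsCMField.complexConj L) v)) | Valued.v ((d : LocalRing L v) w) < 1} := by
    ext d; simp only [Set.mem_setOf_eq, Set.mem_union]; exact le_iff_eq_or_lt
  rw [hset]
  exact measureReal_union (Set.disjoint_left.2 fun d (h1 : Valued.v ((d : LocalRing L v) w) = 1) (h2 : Valued.v ((d : LocalRing L v) w) < 1) => h2.ne h1)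
    (measurableSet_fixedBalls L v w).1 hC hm

/-! ## §1 INVERSION BRIDGE: PART 2 §1's integrand `Ē(c)·Ē(1 + u·c⁻¹)` ↦ the Gauss-sum integrand `E(c)·Ē(1 + u·c)` -/
open scoped Classical in
include hw h₁ hu in
/-- **`∫_C Ē(c)·Ē(1 + u c⁻¹) dν(c) = ∫_C E(c)·Ē(1 + u c) dν(c)`** — ★ tool INVERSION INVARIANCE with the inversion-free `g(r) := E(r)·Ē(1 + u r)` (Borel by ★ `measurable_dite_isUnit`, `|g| ≤ 1` on `C`
since `|u_w| < 1`) and `h(r) := Ē(r)·Ē(1 + u r⁻¹) = g(r⁻¹)` on `C` (`E(r⁻¹) = Ē(r)`). [cite: WeilBNT1967, Ch. II §5] [cite: Keys1984, §4–§5] -/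
theorem setIntegral_fixedUnits_diteInv_mul_eq_dite_mul :
    ∫ c in {c : ↥(HeisRing.fixedPart (conjLocal L (IsCMField.complexConj L) v)) | Valued.v ((c : LocalRing L v) w) = 1},
        (fun r : LocalRing L v => if h : IsUnit r then (((χ₁ h.unit)⁻¹ : ℂˣ) : ℂ) else 0) (c : LocalRing L v) *
          (fun r : LocalRing L v => if h : IsUnit r then (((χ₁ h.unit)⁻¹ : ℂˣ) : ℂ) else 0) (1 + u * ((c : LocalRing L v))⁻¹) ∂ν =
      ∫ c in {c : ↥(HeisRing.fixedPart (conjLocal L (IsCMField.complexConj L) v)) | Valued.v ((c : LocalRing L v) w) = 1},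
        (fun r : LocalRing L v => if h : IsUnit r then ((χ₁ h.unit : ℂˣ) : ℂ) else 0) (c : LocalRing L v) *
          (fun r : LocalRing L v => if h : IsUnit r then (((χ₁ h.unit)⁻¹ : ℂˣ) : ℂ) else 0) (1 + u * (c : LocalRing L v)) ∂ν := by
  have hg : Measurable fun r : LocalRing L v => (fun r : LocalRing L v => if h : IsUnit r then ((χ₁ h.unit : ℂˣ) : ℂ) else 0) r * (fun r : LocalRing L v => if h : IsUnit r then (((χ₁ h.unit)⁻¹ : ℂˣ) : ℂ) else 0) (1 + u * r) :=
    (measurable_dite_isUnit L v w hw (fun x => ((χ₁ x : ℂˣ) : ℂ)) h₁).mul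
      ((measurable_dite_isUnit L v w hw (fun x => (((χ₁ x)⁻¹ : ℂˣ) : ℂ)) (continuous_chiInv L v χ₁ h₁)).comp
        (continuous_const.add (continuous_const.mul continuous_id)).measurable)
  refine setIntegral_fixedUnits_eq_of_forall_eq_inv L v w hw ν
    (fun r : LocalRing L v => (fun r : LocalRing L v => if h : IsUnit r then ((χ₁ h.unit : ℂˣ) : ℂ) else 0) r * (fun r : LocalRing L v => if h : IsUnit r then (((χ₁ h.unit)⁻¹ : ℂˣ) : ℂ) else 0) (1 + u * r))
    (fun r : LocalRing L v => (fun r : LocalRing L v => if h : IsUnit r then (((χ₁ h.unit)⁻¹ : ℂˣ) : ℂ) else 0) r * (fun r : LocalRing L v => if h : IsUnit r then (((χ₁ h.unit)⁻¹ : ℂˣ) : ℂ) else 0) (1 + u * r⁻¹))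
    hg 1 (fun r _ hr => ?_) (fun r _ hr => ?_)
  · beta_reduce
    rw [norm_mul]
    exact mul_le_one₀ (norm_dite_apply_le_one L v w hw χ₁ h₁ r hr) (norm_nonneg _)
      (norm_diteInv_apply_le_one L v w hw χ₁ h₁ _ (valued_one_add_mul_apply_eq_one L v w hu hr.le))
  · beta_reduce
    rw [dite_inv_eq_diteInv L v w hw χ₁ r hr]

/-! ## §2 THE SWAP: the Gauss-sum square as an iterated integral with the inner `u(1+e)`-integral -/
open scoped Classical in
include hw h₁ hu in
/-- **`(∫_C E(c)·Ē(1+uc) dν)² = ∫_C E(e)·(∫_C Ē(1 + u(1+e)c) dν(c)) dν(e)`**: the square is a double integral over `C × C` (bounded Borel integrand, finite measure); for fixed `c ∈ C`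
substitute `c′ = c·e` (★ tool), use `E(c)E(ce) = E(e)` (`hB`) and the exact additivity `Ē(1+uc)Ē(1+uce) = Ē(1+u(1+e)c)` (`hadd`); swap the integrals (Fubini) and pull `E(e)` out.
[cite: IrelandRosen1990, Ch. 8 §2 Prop. 8.2.2] [cite: WeilBNT1967, Ch. II §5] [cite: Keys1984, §4–§5] -/
theorem setIntegral_fixedUnits_gauss_sq_eq
    (hB : ∀ u : (LocalRing L v)ˣ, (∀ w' : PlacesOver L v, Valued.v ((u : LocalRing L v) w') = 1) →
      χ₁ (u * Units.map (conjLocal L (IsCMField.complexConj L) v : LocalRing L v →* LocalRing L v) u) = 1)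
    (hadd : ∀ c e : LocalRing L v, conjLocal L (IsCMField.complexConj L) v c = c → Valued.v (c w) = 1 →
      conjLocal L (IsCMField.complexConj L) v e = e → Valued.v (e w) = 1 →
      (fun r : LocalRing L v => if h : IsUnit r then (((χ₁ h.unit)⁻¹ : ℂˣ) : ℂ) else 0) (1 + u * c) *
          (fun r : LocalRing L v => if h : IsUnit r then (((χ₁ h.unit)⁻¹ : ℂˣ) : ℂ) else 0) (1 + u * (c * e)) =
        (fun r : LocalRing L v => if h : IsUnit r then (((χ₁ h.unit)⁻¹ : ℂˣ) : ℂ) else 0) (1 + u * (1 + e) * c)) :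
    (∫ c in {c : ↥(HeisRing.fixedPart (conjLocal L (IsCMField.complexConj L) v)) | Valued.v ((c : LocalRing L v) w) = 1},
        (fun r : LocalRing L v => if h : IsUnit r then ((χ₁ h.unit : ℂˣ) : ℂ) else 0) (c : LocalRing L v) *
          (fun r : LocalRing L v => if h : IsUnit r then (((χ₁ h.unit)⁻¹ : ℂˣ) : ℂ) else 0) (1 + u * (c : LocalRing L v)) ∂ν) ^ 2 =
      ∫ e in {c : ↥(HeisRing.fixedPart (conjLocal L (IsCMField.complexConj L) v)) | Valued.v ((c : LocalRing L v) w) = 1},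
        (fun r : LocalRing L v => if h : IsUnit r then ((χ₁ h.unit : ℂˣ) : ℂ) else 0) (e : LocalRing L v) *
          ∫ c in {c : ↥(HeisRing.fixedPart (conjLocal L (IsCMField.complexConj L) v)) | Valued.v ((c : LocalRing L v) w) = 1},
            (fun r : LocalRing L v => if h : IsUnit r then (((χ₁ h.unit)⁻¹ : ℂˣ) : ℂ) else 0) (1 + u * (1 + (e : LocalRing L v)) * (c : LocalRing L v)) ∂ν ∂ν := by
  haveI : SecondCountableTopology (LocalRing L v) := secondCountableTopology_localRing (E := L) v
  haveI : SecondCountableTopology ↥(HeisRing.fixedPart (conjLocal L (IsCMField.complexConj L) v)) := TopologicalSpace.Subtype.secondCountableTopology _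
  haveI := HeisRing.locallyCompactSpace_fixedPart (conjLocal L (IsCMField.complexConj L) v) (continuous_conjLocal L (IsCMField.complexConj L) v)
  set C : Set ↥(HeisRing.fixedPart (conjLocal L (IsCMField.complexConj L) v)) := {c | Valued.v ((c : LocalRing L v) w) = 1} with hCdef
  have hCm : MeasurableSet C := (measurableSet_fixedUnits L v w).1
  obtain ⟨-, hCtop⟩ := measure_fixedUnits_pos_lt_top L v w hw ν
  haveI : IsFiniteMeasure (ν.restrict C) := ⟨by rw [Measure.restrict_apply_univ]; exact hCtop⟩
  have hfix : ∀ c : ↥(HeisRing.fixedPart (conjLocal L (IsCMField.complexConj L) v)), conjLocal L (IsCMField.complexConj L) v (c : LocalRing L v) = c :=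
    fun c => (HeisRing.mem_fixedPart_iff _ _).1 c.2
  have hEm : Measurable (fun r : LocalRing L v => if h : IsUnit r then ((χ₁ h.unit : ℂˣ) : ℂ) else 0) := measurable_dite_isUnit L v w hw (fun x => ((χ₁ x : ℂˣ) : ℂ)) h₁
  have hEbm : Measurable (fun r : LocalRing L v => if h : IsUnit r then (((χ₁ h.unit)⁻¹ : ℂˣ) : ℂ) else 0) := measurable_dite_isUnit L v w hw (fun x => (((χ₁ x)⁻¹ : ℂˣ) : ℂ)) (continuous_chiInv L v χ₁ h₁)
  -- the one-variable integrand `f` and the two-variable integrand `F`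
  set f : ↥(HeisRing.fixedPart (conjLocal L (IsCMField.complexConj L) v)) → ℂ := fun c =>
    (fun r : LocalRing L v => if h : IsUnit r then ((χ₁ h.unit : ℂˣ) : ℂ) else 0) (c : LocalRing L v) *
      (fun r : LocalRing L v => if h : IsUnit r then (((χ₁ h.unit)⁻¹ : ℂˣ) : ℂ) else 0) (1 + u * (c : LocalRing L v)) with hfdef
  set F : ↥(HeisRing.fixedPart (conjLocal L (IsCMField.complexConj L) v)) → ↥(HeisRing.fixedPart (conjLocal L (IsCMField.complexConj L) v)) → ℂ := fun c e =>
    (fun r : LocalRing L v => if h : IsUnit r then ((χ₁ h.unit : ℂˣ) : ℂ) else 0) (e : LocalRing L v) *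
      (fun r : LocalRing L v => if h : IsUnit r then (((χ₁ h.unit)⁻¹ : ℂˣ) : ℂ) else 0) (1 + u * (1 + (e : LocalRing L v)) * (c : LocalRing L v)) with hFdef
  have hfm : Measurable f := (hEm.comp measurable_subtype_coe).mul (hEbm.comp (continuous_const.add (continuous_const.mul continuous_subtype_val)).measurable)
  have hFm : Measurable (Function.uncurry F) :=
    (hEm.comp (measurable_subtype_coe.comp measurable_snd)).mul (hEbm.comp
      (continuous_const.add ((continuous_const.mul (continuous_const.add (continuous_subtype_val.comp continuous_snd))).mul
        (continuous_subtype_val.comp continuous_fst))).measurable)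
  have hf1 : ∀ c ∈ C, ‖f c‖ ≤ 1 := fun c hc => by
    rw [hfdef]; beta_reduce; rw [norm_mul]
    exact mul_le_one₀ (norm_dite_apply_le_one L v w hw χ₁ h₁ _ hc) (norm_nonneg _)
      (norm_diteInv_apply_le_one L v w hw χ₁ h₁ _ (valued_one_add_mul_apply_eq_one L v w hu hc.le))
  have hF1 : ∀ c ∈ C, ∀ e ∈ C, ‖F c e‖ ≤ 1 := fun c hc e he => by
    rw [hFdef]; beta_reduce; rw [norm_mul]
    refine mul_le_one₀ (norm_dite_apply_le_one L v w hw χ₁ h₁ _ he) (norm_nonneg _) (norm_diteInv_apply_le_one L v w hw χ₁ h₁ _ ?_)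
    rw [mul_assoc]
    refine valued_one_add_mul_apply_eq_one L v w hu ?_
    rw [Pi.mul_apply, map_mul]
    exact mul_le_one' (valued_one_add_apply_le_one L v w he) hc.le
  -- a.e. membership in `C ×ˢ C` for the product of the restricted measures
  have hae : ∀ᵐ z ∂(ν.restrict C).prod (ν.restrict C), z ∈ C ×ˢ C := by
    rw [Measure.prod_restrict]; exact ae_restrict_mem (hCm.prod hCm)
  have hint1 : Integrable (fun z : ↥(HeisRing.fixedPart (conjLocal L (IsCMField.complexConj L) v)) × ↥(HeisRing.fixedPart (conjLocal L (IsCMField.complexConj L) v)) => f z.1 * f z.2) ((ν.restrict C).prod (ν.restrict C)) :=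
    Integrable.mono' (integrable_const (1 : ℝ)) ((hfm.comp measurable_fst).mul (hfm.comp measurable_snd)).aestronglyMeasurable
      (hae.mono fun z hz => by rw [norm_mul]; exact mul_le_one₀ (hf1 _ hz.1) (norm_nonneg _) (hf1 _ hz.2))
  have hint2 : Integrable (Function.uncurry F) ((ν.restrict C).prod (ν.restrict C)) :=
    Integrable.mono' (integrable_const (1 : ℝ)) hFm.aestronglyMeasurable (hae.mono fun z hz => hF1 _ hz.1 _ hz.2)
  -- Step 1: the square is a double integral
  rw [sq, ← integral_prod_mul f f, integral_prod _ hint1]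
  -- Step 2: inner substitution `c′ = c·e` and the pointwise identity, for `c ∈ C`
  have hinner : ∀ c ∈ C, ∫ c' in C, f c * f c' ∂ν = ∫ e in C, F c e ∂ν := by
    intro c hc
    have hcU := isUnit_of_valued_eq_one L v w hw hc
    have hl : conjLocal L (IsCMField.complexConj L) v (hcU.unit : LocalRing L v) = hcU.unit := by rw [IsUnit.unit_spec]; exact hfix c
    have hlv : Valued.v ((hcU.unit : LocalRing L v) w) = 1 := by rw [IsUnit.unit_spec]; exact hc
    rw [← setIntegral_fixedUnits_comp_smulFixed_eq L v w hw ν hcU.unit hl hlv (fun c' => f c * f c')]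
    refine setIntegral_congr_fun hCm fun e he => ?_
    have hadd' := hadd (c : LocalRing L v) (e : LocalRing L v) (hfix c) hc (hfix e) he
    have hBc := dite_mul_dite_mul_eq_of_branchB L v w hw χ₁ hB (hfix c) hc (e : LocalRing L v)
    show f c * f (HeisRing.smulFixed (conjLocal L (IsCMField.complexConj L) v) hcU.unit hl e) = F c e
    rw [hfdef, hFdef]
    beta_reduce at hadd' ⊢
    rw [HeisRing.coe_smulFixed, IsUnit.unit_spec, mul_mul_mul_comm, hBc, hadd']
  rw [show (∫ c, ∫ c', (fun z : ↥(HeisRing.fixedPart (conjLocal L (IsCMField.complexConj L) v)) × ↥(HeisRing.fixedPart (conjLocal L (IsCMField.complexConj L) v)) =>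
      f z.1 * f z.2) (c, c') ∂ν.restrict C ∂ν.restrict C) = ∫ c in C, ∫ c' in C, f c * f c' ∂ν ∂ν from rfl,
    setIntegral_congr_fun hCm hinner]
  -- Step 3: Fubini swap, then pull `E(e)` out of the inner integral
  rw [integral_integral_swap hint2]
  refine integral_congr_ae (Filter.Eventually.of_forall fun e => ?_)
  show ∫ c in C, F c e ∂ν = _
  rw [hFdef]
  exact integral_const_mul _ _
end Haar

end Summit.HodgeConjecture.HodgeConjecture.R90.S1.BposRamGaussSquarePrep
end
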